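import Summits.CriticalPhenomena.CardyFormulaZ2.Theorems.CardyBondTriangularSwitchingReductionFormats
import Literature.Probability.Percolation.ChayesLeiHexProofs
import Literature.Probability.Percolation.TriSepProbEstimates
import HarnessLib

/-!
# Route CardyBondTriangular · crux `BondTriangularCardy` · line `birth`: the p. 198 equicontinuity estimate from three arms and annulus bounds

Helper of the stub `stub_equicontinuity` (the equicontinuity estimate of the proof of Claim 22
of Bollobás–Riordan, *Percolation* (2006), Ch. 7, p. 198, for the Chayes–Lei separating
probabilities `clSepProb` of a hexagon model `M` on the sites of `𝕋`, in particular critical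
bond percolation on `𝕋`, `M = triBondCritical`). This file is the ASSEMBLY step, the bond-`𝕋`
analogue of the tree's `tri_sepProb_sub_le_of_dualPath_of_arms` followed by the format
conversion `approxSwitching_equi_of_dualPath`: the qualitative estimate
"`fⁱ_δ(z) - fⁱ_δ(w) ≤ β` along `2γ`-local dual chains, eventually" follows from

* (A) the three arms of Claim 10 (p. 177) for the Chayes–Lei separating events: on
  `Eⁱ(z) ∖ Eⁱ(w)` (`z` a dual neighbour of the triangle `w` of the domain) a hexagon of `w` is
  joined by yellow paths of hexagons to the arcs `A_{i+1}`, `A_{i+2}` and a hexagon of `w` by a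
  blue path of hexagons to `Aᵢ` — taken as two hypotheses (yellow arms, blue arm);
* (B) smallness of yellow and of blue annulus crossings (the qualitative form of Lemma 4,
  p. 167: "any upper bound of the form `f(r₋/r₊)` with `f(x) → 0` as `x → 0` suffices"): for
  every `ε > 0` there are a ratio `ρ > 0` and a constant `C` such that an annulus of radii
  `C δ ≤ r₁ ≤ ρ r₂` is crossed by a yellow (resp. blue) path of hexagons of `δ𝕋` with
  probability `≤ ε` — taken as two hypotheses.

Proof as printed (p. 198): along the dual chain there is an edge `xy` with `E(y) ∖ E(x)`; by (A)
the hexagons of `x` carry monochromatic arms to the three arcs; by (35) p. 197 one arc is at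
distance `≥ c` from `w`, so one arm crosses the annulus about `w` of radii `3γ` and `c/2`, which
by (B) has probability `≤ β/2` for each colour once `3γ ≤ ρ c/2` and `C δ ≤ 3γ`.

## References

* B. Bollobás, O. Riordan, *Percolation*, CUP (2006), Ch. 7: proof of Claim 22 p. 198, (35)
  p. 197, Claim 10 p. 177, Lemma 4 pp. 166–167.
* L. Chayes, H. K. Lei, Rev. Math. Phys. 19 (2007), §2.1–2.3.
-/

noncomputable section

namespace Summit.CriticalPhenomena.CardyFormulaZ2.Theorems

open Set Filter Topology Metric MeasureTheory
open Literature.Probability.Percolation Literature.Probability.RandomPlanarGeometry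
open Literature.Probability.RandomPlanarGeometry.MarkedDomain
open Literature.Probability.LatticeModels

/-- `fⁱ(z) - fⁱ(w) ≤ hⁱ(w, z)` for the Chayes–Lei separating probabilities (from (10),
`clSepProb_sub_clSepProb`, and `h ≥ 0`). -/
theorem clSepProb_sub_le_clSepDiffProb (D : TriMarkedDomain 3) (M : ChayesLeiHexPercolation)
    (i : Fin 3) (w z : HexVertex) :
    D.clSepProb M i z - D.clSepProb M i w ≤ D.clSepDiffProb M i w z := by
  rw [D.clSepProb_sub_clSepProb M i w z]
  have h0 : 0 ≤ D.clSepDiffProb M i z w := measureReal_nonneg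
  linarith

/-- **The p. 198 equicontinuity estimate for a Chayes–Lei hexagon model from three arms and
annulus bounds** (Bollobás–Riordan 2006, Ch. 7, proof of Claim 22, p. 198, run for the
separating probabilities `clSepProb` of the hexagon model `M`): if (A) on `Eⁱ(z) ∖ Eⁱ(w)`, `z`
a dual neighbour of a triangle `w` of a 3-marked domain, some hexagon of `w` is yellow-connected
to `A_{i+1}` and to `A_{i+2}` and some hexagon of `w` is blue-connected to `Aᵢ`, and (B) yellow
and blue annulus crossings of `δ𝕋` under `clHexPercolation M` are small (`≤ ε` for radii
`C δ ≤ r₁ ≤ ρ r₂`), then for every discrete approximation `G` of a conformal rectangle and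
`β > 0` there is `γ > 0` with `fⁱ_δ(z) - fⁱ_δ(w) ≤ β` whenever `z` is reached from the triangle
`w` of `G_δ` by a dual chain of triangles of `G_δ` inside `B_{2γ}(w)`, eventually as `δ → 0⁺`. -/
theorem equicontinuity_of_arms_of_annulusBounds : ∀ (M : Literature.Probability.Percolation.ChayesLeiHexPercolation), (∀ (D : Literature.Probability.Percolation.TriMarkedDomain 3) (w : Literature.Probability.LatticeModels.HexVertex) (i j : Fin 3), Literature.Probability.LatticeModels.hexFaceVertices w ⊆ D.verts → D.clSepEvent i (Literature.Probability.Percolation.oppFace w j) \ D.clSepEvent i w ⊆ {σ | ∃ k : Fin 3, (∃ u ∈ D.arc (i + 1), (Literature.Probability.Percolation.clYellowGraph σ).Reachable (Literature.Probability.Percolation.faceVertex w k) u) ∧ (∃ u ∈ D.arc (i + 2), (Literature.Probability.Percolation.clYellowGraph σ).Reachable (Literature.Probability.Percolation.faceVertex w k) u)}) → (∀ (D : Literature.Probability.Percolation.TriMarkedDomain 3) (w : Literature.Probability.LatticeModels.HexVertex) (i j : Fin 3), Literature.Probability.LatticeModels.hexFaceVertices w ⊆ D.verts → D.clSepEvent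 i (Literature.Probability.Percolation.oppFace w j) \ D.clSepEvent i w ⊆ {σ | ∃ k : Fin 3, ∃ u ∈ D.arc i, (Literature.Probability.Percolation.clBlueGraph σ).Reachable (Literature.Probability.Percolation.faceVertex w k) u}) → (∀ ε > (0 : ℝ), ∃ ρ > (0 : ℝ), ∃ C > (0 : ℝ), ∀ (δ : ℝ) (z : ℂ) (r₁ r₂ : ℝ), 0 < δ → C * δ ≤ r₁ → r₁ ≤ ρ * r₂ → (Literature.Probability.Percolation.clHexPercolation M).real {σ | ∃ x y : Literature.Probability.LatticeModels.Site 2, (Literature.Probability.Percolation.clYellowGraph σ).Reachable x y ∧ ‖Literature.Probability.LatticeModels.triMeshPoint δ x - z‖ < r₁ ∧ r₂ < ‖Literature.Probability.LatticeModels.triMeshPoint δ y - z‖} ≤ ε) → (∀ ε > (0 : ℝ), ∃ ρ > (0 : ℝ), ∃ C > (0 : ℝ), ∀ (δ : ℝ) (z : ℂ) (r₁ r₂ : ℝ), 0 < δ → C * δ ≤ r₁ → r₁ ≤ ρ * r₂ → (Literature.Probability.Percolation.clHexPercolation M).real {σ | ∃ x y : Literature.Probability.LatticeModels.Site 2, (Literature.Probability.Percolation.clBlueGraph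 σ).Reachable x y ∧ ‖Literature.Probability.LatticeModels.triMeshPoint δ x - z‖ < r₁ ∧ r₂ < ‖Literature.Probability.LatticeModels.triMeshPoint δ y - z‖} ≤ ε) → ∀ (R : Literature.Probability.RandomPlanarGeometry.ConformalRectangle) (G : ℝ → Literature.Probability.Percolation.TriMarkedDomain 4), Literature.Probability.Percolation.IsDiscreteApprox R G → ∀ β > (0 : ℝ), ∃ γ > (0 : ℝ), ∀ᶠ δ : ℝ in 𝓝[>] 0, ∀ (i : Fin 3) (w z : Literature.Probability.LatticeModels.HexVertex), w ∈ (G δ).faces → Relation.ReflTransGen (fun x y : Literature.Probability.LatticeModels.HexVertex => Literature.Probability.LatticeModels.hexGraph.Adj x y ∧ y ∈ (G δ).faces ∧ dist ((δ : ℂ) * Literature.Probability.LatticeModels.hexCenter w) ((δ : ℂ) * Literature.Probability.LatticeModels.hexCenter y) < 2 * γ) w z → (G δ).dropLast.clSepProb M i z - (G δ).dropLast.clSepProb M i w ≤ β := by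
  intro M hY hB hYb hBb R G hG β hβ
  -- (35): every point of the plane is `≥ a₀` from one of the three arcs of `(Ω; a', b', c')`
  obtain ⟨a₀, ha₀, harc⟩ := (forgetLast R).exists_pos_forall_le_infDist_arc
  set c : ℝ := a₀ / 2 with hc
  have hcpos : 0 < c := by positivity
  -- the annulus bounds at level `β / 2`
  obtain ⟨ρY, hρY, CY, hCY, hYb⟩ := hYb (β / 2) (by positivity)
  obtain ⟨ρB, hρB, CB, hCB, hBb⟩ := hBb (β / 2) (by positivity)
  -- the locality scale `γ`
  set γ : ℝ := min (c / 12) (min (ρY * (c / 2) / 3) (ρB * (c / 2) / 3)) with hγdef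
  have hγ : 0 < γ := lt_min (by positivity) (lt_min (by positivity) (by positivity))
  have hγc : 12 * γ ≤ c := by
    have : γ ≤ c / 12 := min_le_left _ _
    linarith
  have hγY : 3 * γ ≤ ρY * (c / 2) := by
    have : γ ≤ ρY * (c / 2) / 3 := (min_le_right _ _).trans (min_le_left _ _)
    linarith
  have hγB : 3 * γ ≤ ρB * (c / 2) := by
    have : γ ≤ ρB * (c / 2) / 3 := (min_le_right _ _).trans (min_le_right _ _)
    linarith
  obtain ⟨ε, hε, harcs⟩ := hG.arcs_close
  have hεsmall : ∀ᶠ δ in 𝓝[>] (0 : ℝ), ε δ < a₀ / 2 := hε (Iio_mem_nhds (by positivity))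
  have hδsmall : ∀ᶠ δ in 𝓝[>] (0 : ℝ), δ ∈ Ioc 0 (min γ (min (3 * γ / CY) (3 * γ / CB))) :=
    Ioc_mem_nhdsGT (lt_min hγ (lt_min (by positivity) (by positivity)))
  refine ⟨γ, hγ, ?_⟩
  filter_upwards [harcs, hεsmall, hδsmall] with δ harcs hεδ hδ i w' z' hw' hpath
  have hδpos : 0 < δ := hδ.1
  have hδγ : δ ≤ γ := hδ.2.trans (min_le_left _ _)
  have hCYδ : CY * δ ≤ 3 * γ := by
    have h1 : δ ≤ 3 * γ / CY := hδ.2.trans ((min_le_right _ _).trans (min_le_left _ _))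
    rw [le_div_iff₀ hCY] at h1
    linarith
  have hCBδ : CB * δ ≤ 3 * γ := by
    have h1 : δ ≤ 3 * γ / CB := hδ.2.trans ((min_le_right _ _).trans (min_le_right _ _))
    rw [le_div_iff₀ hCB] at h1
    linarith
  -- (35) for the discrete arcs
  have h35 : ∀ u : ℂ, ∃ j : Fin 3, c ≤ infDist u ((G δ).dropLast.arcPts δ j) := by
    intro u
    obtain ⟨j, hj⟩ := harc u
    refine ⟨j, le_trans ?_ (le_infDist_dropLast_arcPts (fun i => (harcs i).2) u j)⟩
    rw [hc]; linarith
  set D : TriMarkedDomain 3 := (G δ).dropLast with hD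
  set K : ℂ := (δ : ℂ) * hexCenter w' with hK
  -- the difference event forces a yellow or a blue crossing of the annulus `A(K; 3γ, c/2)`
  have hsub : D.clSepEvent i z' \ D.clSepEvent i w' ⊆
      {σ | ∃ x y : Site 2, (clYellowGraph σ).Reachable x y ∧ ‖triMeshPoint δ x - K‖ < 3 * γ ∧
          c / 2 < ‖triMeshPoint δ y - K‖} ∪
        {σ | ∃ x y : Site 2, (clBlueGraph σ).Reachable x y ∧ ‖triMeshPoint δ x - K‖ < 3 * γ ∧
          c / 2 < ‖triMeshPoint δ y - K‖} := by
    rintro σ ⟨hz, hw⟩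
    -- the edge `xy` of the dual chain across which `E` switches on
    obtain ⟨x, y, ⟨hxy, hy, hdy⟩, hEx, hEy, hwx⟩ :=
      hpath.exists_step_switch (P := fun F => σ ∈ D.clSepEvent i F) hw hz
    -- `x` is a triangle of the domain within `2γ` of `w'`
    have hx : x ∈ (G δ).faces ∧ dist K ((δ : ℂ) * hexCenter x) < 2 * γ := by
      induction hwx with
      | refl => exact ⟨hw', by rw [hK, dist_self]; positivity⟩
      | tail _ h _ => exact ⟨h.2.1, h.2.2⟩
    obtain ⟨j, rfl⟩ := exists_oppFace_eq_of_hexGraph_adj hxy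
    have hxD : hexFaceVertices x ⊆ D.verts := ((G δ).mem_faces).1 hx.1
    -- the far arc
    obtain ⟨j₀, hj₀⟩ := h35 K
    -- geometry of an arm from a hexagon of `x` to the arc `j₀`
    have key : ∀ (t : Fin 3) (u : Site 2), u ∈ D.arc j₀ →
        ‖triMeshPoint δ (faceVertex x t) - K‖ < 3 * γ ∧ c / 2 < ‖triMeshPoint δ u - K‖ := by
      intro t u hu
      constructor
      · have h1 : dist (triMeshPoint δ (faceVertex x t)) ((δ : ℂ) * hexCenter x) ≤ |δ| :=
          dist_triMeshPoint_hexCenter_le (faceVertex_mem x t) δ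
        rw [abs_of_pos hδpos] at h1
        rw [← dist_eq_norm]
        calc dist (triMeshPoint δ (faceVertex x t)) K
            ≤ dist (triMeshPoint δ (faceVertex x t)) ((δ : ℂ) * hexCenter x) +
                dist ((δ : ℂ) * hexCenter x) K := dist_triangle _ _ _
          _ < δ + 2 * γ := by rw [dist_comm _ K]; exact add_lt_add_of_le_of_lt h1 hx.2
          _ ≤ 3 * γ := by linarith
      · have h1 : c ≤ dist K (triMeshPoint δ u) :=
          hj₀.trans (infDist_le_dist_of_mem ⟨u, Finset.mem_coe.2 hu, rfl⟩)
        rw [← dist_eq_norm, dist_comm]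
        linarith
    -- which arm reaches the far arc
    obtain ⟨t, ht⟩ : ∃ t : Fin 3, j₀ = i + t := ⟨j₀ - i, (add_sub_cancel i j₀).symm⟩
    subst ht
    fin_cases t
    · -- the blue arm to `A_i`
      obtain ⟨k, u, hu, hreach⟩ := hB D x i j hxD ⟨hEy, hEx⟩
      refine Or.inr ⟨faceVertex x k, u, hreach, ?_⟩
      exact key k u (by simpa using hu)
    · -- a yellow arm to `A_{i+1}`
      obtain ⟨k, ⟨u, hu, hreach⟩, -⟩ := hY D x i j hxD ⟨hEy, hEx⟩
      refine Or.inl ⟨faceVertex x k, u, hreach, ?_⟩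
      exact key k u (by simpa using hu)
    · -- a yellow arm to `A_{i+2}`
      obtain ⟨k, -, ⟨u, hu, hreach⟩⟩ := hY D x i j hxD ⟨hEy, hEx⟩
      refine Or.inl ⟨faceVertex x k, u, hreach, ?_⟩
      exact key k u (by simpa using hu)
  -- the two annulus bounds
  have hbY := hYb δ K (3 * γ) (c / 2) hδpos hCYδ hγY
  have hbB := hBb δ K (3 * γ) (c / 2) hδpos hCBδ hγB
  calc D.clSepProb M i z' - D.clSepProb M i w' ≤ D.clSepDiffProb M i w' z' :=
        clSepProb_sub_le_clSepDiffProb D M i w' z'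
    _ ≤ (clHexPercolation M).real
          ({σ | ∃ x y : Site 2, (clYellowGraph σ).Reachable x y ∧ ‖triMeshPoint δ x - K‖ < 3 * γ ∧
              c / 2 < ‖triMeshPoint δ y - K‖} ∪
            {σ | ∃ x y : Site 2, (clBlueGraph σ).Reachable x y ∧ ‖triMeshPoint δ x - K‖ < 3 * γ ∧
              c / 2 < ‖triMeshPoint δ y - K‖}) := measureReal_mono hsub
    _ ≤ (clHexPercolation M).real
          {σ | ∃ x y : Site 2, (clYellowGraph σ).Reachable x y ∧ ‖triMeshPoint δ x - K‖ < 3 * γ ∧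
              c / 2 < ‖triMeshPoint δ y - K‖} +
        (clHexPercolation M).real
          {σ | ∃ x y : Site 2, (clBlueGraph σ).Reachable x y ∧ ‖triMeshPoint δ x - K‖ < 3 * γ ∧
              c / 2 < ‖triMeshPoint δ y - K‖} := measureReal_union_le _ _
    _ ≤ β / 2 + β / 2 := add_le_add hbY hbB
    _ = β := by ring

end Summit.CriticalPhenomena.CardyFormulaZ2.Theorems

end
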